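import Literature.NumberTheory.EllipticCurves.KummerHomsFinite
import Mathlib.NumberTheory.NumberField.ClassNumber
import Mathlib.Algebra.GroupWithZero.Units.Fintype
import HarnessLib

/-!
# Counting `K(S, n)` and the characters unramified outside `S`
# (quantitative form of Silverman AEC Prop. VIII.1.6; `#ℚ(S, 2) ≤ 2^{#S + 1}`)

`Proofs` companion of `KummerSelmerGroupFinite` / `KummerHomsFinite`, which prove that Mathlib's
Selmer group `K⟮S, n⟯ = {b ∈ Kˣ/(Kˣ)ⁿ : n ∣ ord_v(b) ∀ v ∉ S}` of a number field
(`IsDedekindDomain.selmerGroup`) is *finite* and that the additive characters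
`Gal(Ω/k) → ℤ/dℤ` unramified outside `S` form a *finite* set (Silverman, *The Arithmetic of
Elliptic Curves*, 2nd ed., Prop. VIII.1.6 and its proof). Here the same arguments are run with
cardinalities instead of finiteness, giving the explicit bounds that quantitative descent needs
(e.g. the classical `#Sel^{(2)}(E/ℚ) ≤ 4^{#S+1}` for curves with a rational `2`-torsion point,
file `SelmerTwoTorsionBoundProofs`):

* `IsDedekindDomain.selmerGroup.natCard_empty_le` — for a Dedekind domain `R` with finite class
  group and finite `Rˣ/(Rˣ)ⁿ`: `#K(∅, n) ≤ #Cl(R) · #(Rˣ/(Rˣ)ⁿ)` (the exact sequence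
  `1 → Rˣ/(Rˣ)ⁿ → K(∅, n) → Cl(R)[n] → 0` of the Mathlib docstring, used set-theoretically exactly
  as in `selmerGroup.finite_empty_of_finite_classGroup`: every `s ∈ K(∅, n)` is `[r]` with
  `(r) = Jⁿ`, and `s ↦ ([J], unit correcting s against a base point of its fibre)` is injective).
* `IsDedekindDomain.selmerGroup.natCard_le` — `#K(S, n) ≤ #Cl(R) · #(Rˣ/(Rˣ)ⁿ) · n^{#S}` for finite
  `S` (Mathlib's valuation map `K⟮S, n⟯ → (S → ℤ/n)` has kernel `K⟮∅, n⟯`,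
  `IsDedekindDomain.selmerGroup.valuation_ker_eq`).
* `Rat.natCard_selmerGroup_le` — **`#ℚ(S, n) ≤ 2 · n^{#S}`**, in particular
  `Rat.natCard_selmerGroup_two_le`: **`#ℚ(S, 2) ≤ 2^{#S+1}`** (`h_ℚ = 1`, `Rat.classNumber_eq`;
  `(𝓞 ℚ)ˣ = {±1}`, `Rat.ringOfIntegersEquiv` and `Fintype.card_units_int`). (For `S ∋ 2` this
  is an equality, `ℚ(S, 2) = ⟨−1, p ∈ S⟩`; only the bound is proved.)
* `Literature.NumberTheory.EllipticCurves.ncard_kummerUnramifiedHoms_le` — **Prop. VIII.1.6,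
  counted**: with `k ∋ ζ_d`, `Ω/k` Galois, `S` finite, the set of additive maps
  `f : Gal(Ω/k) → ℤ/dℤ` vanishing on some `Gal(Ω/E)` (`E/k` finite) and on every inertia group
  `I_𝔓`, `𝔓 ∣ w ∉ S`, has at most `#k(S, d)` elements (the Kummer class `f ↦ [a_f]` is an
  injection into `k(S, d)`, verbatim from `finite_kummerUnramifiedHoms`).
* `Literature.NumberTheory.EllipticCurves.Rat.ncard_kummerUnramifiedHoms_two_le` — over `k = ℚ`,
  `d = 2` (`ζ = −1`): at most `2^{#S+1}` quadratic characters of `Gal(Ω/ℚ)` are unramified outside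
  `S`.

## References

* J. H. Silverman, *The Arithmetic of Elliptic Curves*, 2nd ed., GTM 106 (2009), Prop. VIII.1.6
  and its proof (p. 189: `T_S` finite via the `S`-unit theorem), Remark X.1.2, and X.§1
  Example 1.5 ff. (`ℚ(S, 2)` generated by `−1` and the primes of `S`).
  [cite: SilvermanAEC2009, proof of Prop. VIII.1.6]

## Mathlib / tree reuse

Mathlib: `IsDedekindDomain.selmerGroup`, `selmerGroup.valuation(_ker_eq)`, `selmerGroup.monotone`,
`Subgroup.card_mul_index`, `Subgroup.index_ker`, `Nat.card_fun`, `Nat.card_prod`,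
`Nat.card_le_card_of_injective`, `Rat.classNumber_eq`, `Rat.ringOfIntegersEquiv`,
`Units.mapEquiv`, `Fintype.card_units_int`, `IsPrimitiveRoot.neg_one`. Tree:
`IsDedekindDomain.exists_mk_eq_of_pos`, `exists_pow_eq_span_singleton_of_dvd_count`,
`valuationOfNeZeroMod_mk_eq_one_iff`, `toAdd_valuationOfNeZero_of_eq_algebraMap`,
`selmerGroup.finite_empty_of_finite_classGroup`, `NumberField.Units.finite_quotient_range_powMonoidHom`,
`NumberField.finite_selmerGroup` (`KummerSelmerGroupFinite`); `exists_kummer_generator`,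
`kummer_generator_injective`, `dvd_log_valuation_of_inertia_fixes_root` (`KummerHomsFinite`,
`KummerUnramified`). Mathlib search: no cardinality statement about `selmerGroup` (its file lists
finiteness itself as TODO).

## Design

No definitions. As in `KummerSelmerGroupFinite`, statements about Mathlib's `selmerGroup` are
deliberate dot-notation extensions in the namespace `IsDedekindDomain.selmerGroup`, and the
`ℚ`-specialisations live in `Rat`; the character count lives in the path namespace
`Literature.NumberTheory.EllipticCurves` next to `finite_kummerUnramifiedHoms`.
-/

noncomputable section

open scoped NumberField nonZeroDivisors

open NumberField IsDedekindDomain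

universe u

namespace IsDedekindDomain

variable {R : Type*} [CommRing R] [IsDedekindDomain R] {K : Type*} [Field K] [Algebra R K]
  [IsFractionRing R K]

/-- **`#K(∅, n) ≤ #Cl(R) · #(Rˣ/(Rˣ)ⁿ)`** for the fraction field `K` of a Dedekind domain `R` with
finite class group and finite `Rˣ/(Rˣ)ⁿ` (`0 < n`). Every `s ∈ K(∅, n)` has an integral
representative `r_s` with `(r_s) = J_sⁿ`; two classes with `[J_s] = [J_t]` differ by the image of a
unit, so `s ↦ ([J_s], ē_s)`, with `e_s ∈ Rˣ` correcting `s` against a chosen base point of its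
fibre, is injective into `Cl(R) × Rˣ/(Rˣ)ⁿ`. This is the exact sequence
`1 → Rˣ/(Rˣ)ⁿ → K(∅, n) → Cl(R)[n] → 0` (Mathlib docstring of `IsDedekindDomain.selmerGroup`)
counted; Silverman, *AEC*, proof of Prop. VIII.1.6 (`R_S^*/(R_S^*)^m ↠ T_S` once `R_S` is
principal). [cite: SilvermanAEC2009, proof of Prop. VIII.1.6] -/
theorem selmerGroup.natCard_empty_le [Finite (ClassGroup R)] {n : ℕ} (hn : 0 < n)
    (hU : Finite (Rˣ ⧸ (powMonoidHom n : Rˣ →* Rˣ).range)) :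
    Nat.card (selmerGroup (K := K) (S := (∅ : Set (HeightOneSpectrum R))) (n := n)) ≤
      Nat.card (ClassGroup R) * Nat.card (Rˣ ⧸ (powMonoidHom n : Rˣ →* Rˣ).range) := by
  classical
  -- the map `u : Rˣ → Kˣ/(Kˣ)ⁿ`; it kills `n`-th powers
  set u : Rˣ →* Kˣ ⧸ (powMonoidHom n : Kˣ →* Kˣ).range :=
    (QuotientGroup.mk' _).comp (Units.map (algebraMap R K : R →* K)) with hu
  have hle : (powMonoidHom n : Rˣ →* Rˣ).range ≤ u.ker := by
    rintro _ ⟨e, rfl⟩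
    rw [MonoidHom.mem_ker, hu, MonoidHom.comp_apply, QuotientGroup.mk'_apply,
      QuotientGroup.eq_one_iff, powMonoidHom_apply, map_pow]
    exact MonoidHom.mem_range.mpr ⟨Units.map (algebraMap R K : R →* K) e, rfl⟩
  -- integral representatives `x s = r s ∈ R` of `s ∈ K(∅, n)` and ideals `J s` with
  -- `(J s)ⁿ = (r s)`
  have key : ∀ s : selmerGroup (K := K) (S := (∅ : Set (HeightOneSpectrum R))) (n := n),
      ∃ (r : R) (x : Kˣ) (J : (Ideal R)⁰), r ≠ 0 ∧ (x : K) = algebraMap R K r ∧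
        (QuotientGroup.mk x : Kˣ ⧸ (powMonoidHom n : Kˣ →* Kˣ).range) = s ∧
          (J : Ideal R) ^ n = Ideal.span {r} := by
    intro s
    obtain ⟨r, x, hr, hx, hs⟩ :=
      exists_mk_eq_of_pos (R := R) hn (s : Kˣ ⧸ (powMonoidHom n : Kˣ →* Kˣ).range)
    have hdvd : ∀ v : HeightOneSpectrum R,
        n ∣ (Associates.mk v.asIdeal).count (Associates.mk (Ideal.span {r})).factors := by
      intro v
      have h1 : v.valuationOfNeZeroMod n (s : Kˣ ⧸ (powMonoidHom n : Kˣ →* Kˣ).range) = 1 :=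
        s.2 v (Set.notMem_empty v)
      rw [← hs, v.valuationOfNeZeroMod_mk_eq_one_iff,
        v.toAdd_valuationOfNeZero_of_eq_algebraMap hr hx, dvd_neg] at h1
      exact_mod_cast h1
    obtain ⟨J, hJ⟩ := exists_pow_eq_span_singleton_of_dvd_count hr hdvd
    have hJ0 : J ∈ (Ideal R)⁰ := by
      rw [mem_nonZeroDivisors_iff_ne_zero]
      rintro rfl
      rw [Ideal.zero_eq_bot, ← Ideal.zero_eq_bot, zero_pow hn.ne', Ideal.zero_eq_bot, eq_comm,
        Ideal.span_singleton_eq_bot] at hJ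
      exact hr hJ
    exact ⟨r, x, ⟨J, hJ0⟩, hr, hx, hs, hJ⟩
  choose r x J hr hx hs hJ using key
  -- the class of `J s`; two points of a fibre differ by the image of a unit
  let f : selmerGroup (K := K) (S := (∅ : Set (HeightOneSpectrum R))) (n := n) → ClassGroup R :=
    fun s => ClassGroup.mk0 (J s)
  have hfib : ∀ s t, f t = f s →
      ∃ e : Rˣ, (s : Kˣ ⧸ (powMonoidHom n : Kˣ →* Kˣ).range) = t * u e := by
    intro s t hst
    obtain ⟨c, d, hc, hd, hcd⟩ := ClassGroup.mk0_eq_mk0_iff.mp hst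
    have h2 : Ideal.span {c ^ n * r t} = Ideal.span {d ^ n * r s} := by
      have := congrArg (· ^ n) hcd
      simp only [mul_pow, Ideal.span_singleton_pow, hJ] at this
      rwa [Ideal.span_singleton_mul_span_singleton, Ideal.span_singleton_mul_span_singleton] at this
    obtain ⟨e, he⟩ := Ideal.span_singleton_eq_span_singleton.mp h2
    have hcK : algebraMap R K c ≠ 0 := (map_ne_zero_iff _ (IsFractionRing.injective R K)).mpr hc
    have hdK : algebraMap R K d ≠ 0 := (map_ne_zero_iff _ (IsFractionRing.injective R K)).mpr hd
    have hunits : Units.mk0 _ hcK ^ n * x t * Units.map (algebraMap R K : R →* K) e =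
        Units.mk0 _ hdK ^ n * x s := by
      ext
      simp only [Units.val_mul, Units.val_pow_eq_pow_val, Units.val_mk0, Units.coe_map,
        MonoidHom.coe_coe, hx, ← map_pow, ← map_mul, he]
    refine ⟨e, ?_⟩
    rw [← hs, ← hs, hu, MonoidHom.comp_apply, QuotientGroup.mk'_apply, ← QuotientGroup.mk_mul,
      QuotientGroup.eq]
    refine MonoidHom.mem_range.mpr ⟨Units.mk0 _ hdK / Units.mk0 _ hcK, ?_⟩
    rw [powMonoidHom_apply, div_pow, div_eq_iff_eq_mul, mul_assoc, eq_inv_mul_iff_mul_eq]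
    simpa only [mul_comm, mul_assoc, mul_left_comm] using hunits.symm
  -- a base point in each nonempty fibre, and the correcting units
  have hbase : ∀ g : Set.range f, ∃ t, f t = g := fun g ↦ g.2
  choose base hbase using hbase
  have hrep : ∀ s : selmerGroup (K := K) (S := (∅ : Set (HeightOneSpectrum R))) (n := n),
      ∃ e : Rˣ, (s : Kˣ ⧸ (powMonoidHom n : Kˣ →* Kˣ).range) = base ⟨f s, s, rfl⟩ * u e :=
    fun s ↦
    hfib s (base ⟨f s, s, rfl⟩) (hbase ⟨f s, s, rfl⟩)
  choose e he using hrep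
  -- the injection `s ↦ ([J s], ē s)`
  let Φ : selmerGroup (K := K) (S := (∅ : Set (HeightOneSpectrum R))) (n := n) →
      ClassGroup R × (Rˣ ⧸ (powMonoidHom n : Rˣ →* Rˣ).range) :=
    fun s ↦ (f s, QuotientGroup.mk (e s))
  have hΦ : Function.Injective Φ := by
    intro s t hst
    simp only [Φ, Prod.mk.injEq] at hst
    obtain ⟨h1, h2⟩ := hst
    have hu' : u (e s) = u (e t) := by
      obtain ⟨c, hc⟩ := MonoidHom.mem_range.mp (QuotientGroup.eq.mp h2)
      have hk : (e s)⁻¹ * e t ∈ u.ker := hle (MonoidHom.mem_range.mpr ⟨c, hc⟩)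
      rwa [MonoidHom.mem_ker, map_mul, map_inv, inv_mul_eq_one] at hk
    have hb : base ⟨f s, s, rfl⟩ = base ⟨f t, t, rfl⟩ := by
      congr 1
      exact Subtype.ext h1
    apply Subtype.ext
    rw [he s, he t, hb, hu']
  calc Nat.card (selmerGroup (K := K) (S := (∅ : Set (HeightOneSpectrum R))) (n := n))
      ≤ Nat.card (ClassGroup R × (Rˣ ⧸ (powMonoidHom n : Rˣ →* Rˣ).range)) :=
        Nat.card_le_card_of_injective Φ hΦ
    _ = Nat.card (ClassGroup R) * Nat.card (Rˣ ⧸ (powMonoidHom n : Rˣ →* Rˣ).range) :=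
        Nat.card_prod _ _

/-- **`#K(S, n) ≤ #Cl(R) · #(Rˣ/(Rˣ)ⁿ) · n^{#S}`** for finite `S` and `0 < n` (finite class group,
finite `Rˣ/(Rˣ)ⁿ`): Mathlib's valuation map `K⟮S, n⟯ → (S → ℤ/n)` has kernel `K⟮∅, n⟯`
(`IsDedekindDomain.selmerGroup.valuation_ker_eq`) and a target with `n^{#S}` elements, and
`#K⟮S, n⟯ = #ker · #image`. Silverman, *AEC*, proof of Prop. VIII.1.6 (the map
`T_S → ∏_{v ∈ S} ℤ/mℤ`). [cite: SilvermanAEC2009, proof of Prop. VIII.1.6] -/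
theorem selmerGroup.natCard_le [Finite (ClassGroup R)] {S : Set (HeightOneSpectrum R)}
    (hS : S.Finite) {n : ℕ} (hn : 0 < n) (hU : Finite (Rˣ ⧸ (powMonoidHom n : Rˣ →* Rˣ).range)) :
    Nat.card (selmerGroup (K := K) (S := S) (n := n)) ≤
      Nat.card (ClassGroup R) * Nat.card (Rˣ ⧸ (powMonoidHom n : Rˣ →* Rˣ).range) *
        n ^ Nat.card S := by
  classical
  haveI : NeZero n := ⟨hn.ne'⟩
  haveI : Fintype S := hS.fintype
  haveI : Finite (selmerGroup (K := K) (S := (∅ : Set (HeightOneSpectrum R))) (n := n)) :=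
    selmerGroup.finite_empty_of_finite_classGroup hn hU
  set val := selmerGroup.valuation (K := K) (S := S) (n := n) with hval
  have hker : Nat.card val.ker =
      Nat.card (selmerGroup (K := K) (S := (∅ : Set (HeightOneSpectrum R))) (n := n)) := by
    rw [hval, selmerGroup.valuation_ker_eq]
    exact Nat.card_congr
      (Subgroup.subgroupOfEquivOfLe (selmerGroup.monotone (Set.empty_subset S))).toEquiv
  have h1 : Nat.card (selmerGroup (K := K) (S := S) (n := n)) =
      Nat.card val.ker * val.ker.index := (Subgroup.card_mul_index _).symm
  have h2 : val.ker.index = Nat.card val.range := Subgroup.index_ker val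
  have h3 : Nat.card val.range ≤ Nat.card (S → Multiplicative (ZMod n)) :=
    Nat.card_le_card_of_injective (fun y : val.range ↦ (y : S → Multiplicative (ZMod n)))
      Subtype.val_injective
  have h4 : Nat.card (S → Multiplicative (ZMod n)) = n ^ Nat.card S := by
    rw [Nat.card_fun, Nat.card_eq_fintype_card (α := Multiplicative (ZMod n)),
      Fintype.card_multiplicative, ZMod.card]
  calc Nat.card (selmerGroup (K := K) (S := S) (n := n))
      = Nat.card (selmerGroup (K := K) (S := (∅ : Set (HeightOneSpectrum R))) (n := n)) *
          Nat.card val.range := by rw [h1, hker, h2]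
    _ ≤ (Nat.card (ClassGroup R) * Nat.card (Rˣ ⧸ (powMonoidHom n : Rˣ →* Rˣ).range)) *
          n ^ Nat.card S := by
        rw [← h4]
        exact Nat.mul_le_mul (selmerGroup.natCard_empty_le hn hU) h3

end IsDedekindDomain

/-! ## The case `K = ℚ` -/

namespace Rat

open IsDedekindDomain

/-- `(𝓞 ℚ)ˣ = {±1}` has two elements (`𝓞 ℚ ≅ ℤ`, `Rat.ringOfIntegersEquiv`). [folklore] -/
theorem natCard_units_ringOfIntegers : Nat.card (𝓞 ℚ)ˣ = 2 := by
  rw [Nat.card_congr (Units.mapEquiv Rat.ringOfIntegersEquiv.toMulEquiv).toEquiv,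
    Nat.card_eq_fintype_card, Fintype.card_units_int]

/-- The class group of `𝓞 ℚ` is trivial (`Rat.classNumber_eq`), as a `Nat.card`. [folklore] -/
theorem natCard_classGroup_ringOfIntegers : Nat.card (ClassGroup (𝓞 ℚ)) = 1 := by
  rw [Nat.card_eq_fintype_card]
  exact Rat.classNumber_eq

/-- **`#ℚ(S, n) ≤ 2 · n^{#S}`** for a finite set `S` of primes (finite places of `ℚ`) and `0 < n`:
the general bound `#Cl · #(units mod n-th powers) · n^{#S}` with `h_ℚ = 1` and
`#((𝓞 ℚ)ˣ/((𝓞 ℚ)ˣ)ⁿ) ≤ #(𝓞 ℚ)ˣ = 2`. Silverman, *AEC*, X.§1 (Example 1.5: for `ℚ` the group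
`ℚ(S, 2)` is generated by `−1` and the primes of `S`). [cite: SilvermanAEC2009, proof of Prop. VIII.1.6] -/
theorem natCard_selmerGroup_le {S : Set (HeightOneSpectrum (𝓞 ℚ))} (hS : S.Finite) {n : ℕ}
    (hn : 0 < n) :
    Nat.card (selmerGroup (R := 𝓞 ℚ) (K := ℚ) (S := S) (n := n)) ≤ 2 * n ^ Nat.card S := by
  haveI : NeZero n := ⟨hn.ne'⟩
  have hU : Finite ((𝓞 ℚ)ˣ ⧸ (powMonoidHom n : (𝓞 ℚ)ˣ →* (𝓞 ℚ)ˣ).range) :=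
    NumberField.Units.finite_quotient_range_powMonoidHom ℚ n
  haveI : Finite (𝓞 ℚ)ˣ := Nat.finite_of_card_ne_zero (by rw [natCard_units_ringOfIntegers]; decide)
  have hq : Nat.card ((𝓞 ℚ)ˣ ⧸ (powMonoidHom n : (𝓞 ℚ)ˣ →* (𝓞 ℚ)ˣ).range) ≤ 2 := by
    rw [← natCard_units_ringOfIntegers]
    exact Nat.card_le_card_of_surjective _ (QuotientGroup.mk_surjective)
  calc Nat.card (selmerGroup (R := 𝓞 ℚ) (K := ℚ) (S := S) (n := n))
      ≤ Nat.card (ClassGroup (𝓞 ℚ)) *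
          Nat.card ((𝓞 ℚ)ˣ ⧸ (powMonoidHom n : (𝓞 ℚ)ˣ →* (𝓞 ℚ)ˣ).range) * n ^ Nat.card S :=
        selmerGroup.natCard_le hS hn hU
    _ ≤ 1 * 2 * n ^ Nat.card S := by
        rw [natCard_classGroup_ringOfIntegers]
        gcongr
    _ = 2 * n ^ Nat.card S := by rw [one_mul]

/-- **`#ℚ(S, 2) ≤ 2^{#S+1}`** for a finite set `S` of primes. (Equality holds when `2 ∈ S`:
`ℚ(S, 2) = ⟨−1, p ∈ S⟩ ⊆ ℚˣ/(ℚˣ)²`, Silverman, *AEC*, X.§1 Example 1.5; only the bound is proved.)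
[cite: SilvermanAEC2009, proof of Prop. VIII.1.6] -/
theorem natCard_selmerGroup_two_le {S : Set (HeightOneSpectrum (𝓞 ℚ))} (hS : S.Finite) :
    Nat.card (selmerGroup (R := 𝓞 ℚ) (K := ℚ) (S := S) (n := 2)) ≤ 2 ^ (Nat.card S + 1) := by
  rw [pow_succ, mul_comm]
  exact natCard_selmerGroup_le hS two_pos

end Rat

/-! ## Counting the characters unramified outside `S` -/

namespace Literature.NumberTheory.EllipticCurves

open IntermediateField

section Count

variable {k : Type u} [Field k] [NumberField k] {Ω : Type u} [Field Ω] [Algebra k Ω] [IsGalois k Ω]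

/-- **Silverman, AEC Prop. VIII.1.6, counted.** Let `k` be a number field containing a primitive
`d`-th root of unity `ζ` (`0 < d`), `Ω/k` Galois, and `S` a finite set of finite places of `k`.
Then the set `F` of additive maps `f : Gal(Ω/k) → ℤ/dℤ` that vanish on `Gal(Ω/E)` for some
finite `E/k` and on the inertia group `I_𝔓 ≤ Gal(Ω/k)` of every prime `𝔓` (of the integral
closure of `𝓞 k` in `Ω`) above a finite place `w ∉ S` has **at most `#k(S, d)` elements**: the
Kummer class `f ↦ [a_f] ∈ kˣ/(kˣ)^d` (`exists_kummer_generator`) is injective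
(`kummer_generator_injective`) with values in `k(S, d)`
(`dvd_log_valuation_of_inertia_fixes_root`) — the injection of `finite_kummerUnramifiedHoms`,
now counted. [cite: SilvermanAEC2009, Prop. VIII.1.6 (proof)] -/
theorem ncard_kummerUnramifiedHoms_le {d : ℕ} (hd : 0 < d) {ζ : k} (hζ : IsPrimitiveRoot ζ d)
    {S : Set (HeightOneSpectrum (𝓞 k))} (hS : S.Finite)
    (F : Set ((Ω ≃ₐ[k] Ω) → ZMod d))
    (hadd : ∀ f ∈ F, ∀ σ τ, f (σ * τ) = f σ + f τ)
    (hfin : ∀ f ∈ F, ∃ E : IntermediateField k Ω, FiniteDimensional k E ∧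
      ∀ σ ∈ E.fixingSubgroup, f σ = 0)
    (hunr : ∀ f ∈ F, ∀ w : HeightOneSpectrum (𝓞 k), w ∉ S →
      ∀ 𝔓 : Ideal (integralClosure (𝓞 k) Ω), 𝔓.IsMaximal → 𝔓.LiesOver w.asIdeal →
        ∀ σ ∈ 𝔓.inertia (Ω ≃ₐ[k] Ω), f σ = 0) :
    F.ncard ≤ Nat.card (IsDedekindDomain.selmerGroup (R := 𝓞 k) (K := k) (S := S) (n := d)) := by
  classical
  haveI : NeZero d := ⟨hd.ne'⟩
  -- Kummer generators, chosen once for each `f ∈ F`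
  have hgen : ∀ f : F, ∃ a : k, a ≠ 0 ∧ ∃ α : Ω, α ^ d = algebraMap k Ω a ∧
      ∀ σ : Ω ≃ₐ[k] Ω, σ α = algebraMap k Ω ζ ^ (f.1 σ).val * α := fun f ↦
    exists_kummer_generator hd hζ f.1 (hadd f.1 f.2) (hfin f.1 f.2)
  choose a ha α hα hσα using hgen
  -- the Kummer class `[a_f] ∈ kˣ/(kˣ)^d`
  let cls : F → kˣ ⧸ (powMonoidHom d : kˣ →* kˣ).range := fun f ↦
    QuotientGroup.mk (Units.mk0 (a f) (ha f))
  -- it lies in `k(S, d)`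
  have hmem : ∀ f : F, cls f ∈
      IsDedekindDomain.selmerGroup (R := 𝓞 k) (K := k) (S := S) (n := d) := by
    intro f
    rw [IsDedekindDomain.mk_mem_selmerGroup_iff]
    intro w hw
    rw [Units.val_mk0]
    haveI := w.isMaximal
    obtain ⟨𝔓, h𝔓max, h𝔓over⟩ := Ideal.exists_maximal_ideal_liesOver_of_isIntegral
      (S := integralClosure (𝓞 k) Ω) w.asIdeal
    haveI := h𝔓max.isPrime
    haveI := h𝔓over
    refine dvd_log_valuation_of_inertia_fixes_root hd hζ (ha f) (hα f) w 𝔓 fun σ hσ ↦ ?_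
    rw [hσα f σ, hunr f.1 f.2 w hw 𝔓 h𝔓max h𝔓over σ hσ, ZMod.val_zero, pow_zero, one_mul]
  -- and determines `f`
  have hinj : Function.Injective cls := by
    intro f₁ f₂ h
    obtain ⟨c, hc⟩ := QuotientGroup.eq.mp h
    apply Subtype.ext
    refine kummer_generator_injective hd hζ (ha f₁) (ha f₂) (hα f₁) (hα f₂) (hσα f₁) (hσα f₂)
      (b := (c : k)) ?_
    have hc' := congrArg (fun u : kˣ ↦ (u : k)) hc
    simp only [powMonoidHom_apply, Units.val_mul, Units.val_inv_eq_inv_val, Units.val_mk0,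
      Units.val_pow_eq_pow_val] at hc'
    rw [hc', mul_inv_cancel_left₀ (ha f₁)]
  -- so `F` embeds into the finite group `k(S, d)`
  haveI := NumberField.finite_selmerGroup (K := k) hS hd
  rw [← Nat.card_coe_set_eq]
  exact Nat.card_le_card_of_injective
    (fun f : F ↦ (⟨cls f, hmem f⟩ :
      IsDedekindDomain.selmerGroup (R := 𝓞 k) (K := k) (S := S) (n := d)))
    (fun f₁ f₂ h ↦ hinj (congrArg Subtype.val h))

end Count

/-- **Quadratic characters of `Gal(Ω/ℚ)` unramified outside `S` are at most `2^{#S+1}` in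
number.** For `Ω/ℚ` Galois and a finite set `S` of primes, the additive maps
`f : Gal(Ω/ℚ) → ℤ/2ℤ` vanishing on some `Gal(Ω/E)` (`E/ℚ` finite) and on all inertia groups
above the primes outside `S` number at most `#ℚ(S, 2) ≤ 2^{#S+1}`
(`ncard_kummerUnramifiedHoms_le` with `ζ = −1`, and `Rat.natCard_selmerGroup_two_le`). These are
the characters cutting out the fields `ℚ(√D)`, `D ∈ ⟨−1, p ∈ S⟩`. Silverman, *AEC*, X.§1
(Example 1.5) and Prop. VIII.1.6. [cite: SilvermanAEC2009, Prop. VIII.1.6 (proof)] -/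
theorem Rat.ncard_kummerUnramifiedHoms_two_le {Ω : Type} [Field Ω] [Algebra ℚ Ω] [IsGalois ℚ Ω]
    {S : Set (HeightOneSpectrum (𝓞 ℚ))} (hS : S.Finite)
    (F : Set ((Ω ≃ₐ[ℚ] Ω) → ZMod 2))
    (hadd : ∀ f ∈ F, ∀ σ τ, f (σ * τ) = f σ + f τ)
    (hfin : ∀ f ∈ F, ∃ E : IntermediateField ℚ Ω, FiniteDimensional ℚ E ∧
      ∀ σ ∈ E.fixingSubgroup, f σ = 0)
    (hunr : ∀ f ∈ F, ∀ w : HeightOneSpectrum (𝓞 ℚ), w ∉ S →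
      ∀ 𝔓 : Ideal (integralClosure (𝓞 ℚ) Ω), 𝔓.IsMaximal → 𝔓.LiesOver w.asIdeal →
        ∀ σ ∈ 𝔓.inertia (Ω ≃ₐ[ℚ] Ω), f σ = 0) :
    F.ncard ≤ 2 ^ (Nat.card S + 1) := by
  have hζ : IsPrimitiveRoot (-1 : ℚ) 2 := IsPrimitiveRoot.neg_one 0 (by norm_num)
  exact (ncard_kummerUnramifiedHoms_le two_pos hζ hS F hadd hfin hunr).trans
    (_root_.Rat.natCard_selmerGroup_two_le hS)

end Literature.NumberTheory.EllipticCurves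

end
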